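import Summits.CriticalPhenomena.PercolationContinuityZ3.Theses.PercNearOneGluing
import Summits.CriticalPhenomena.PercolationContinuityZ3.Theorems.PercNearOneGluingNoHeavyLowerTailCSHTheoremOne
import HarnessLib

/-!
# `AdditiveGluing` (stmt-CriticalPhenomena-4576) — the additive gluing engine of route `PercNearOneGluing`, PROVED

Closing file for the crux `AdditiveGluing` (registered crux declaration
`Summit.CriticalPhenomena.PercolationContinuityZ3.Theses.PercNearOneGluing.AdditiveGluing`):
on every finite weighted graph (`prodBernoulli w` on `Sym2 (Fin n)`), for every relay set `A`,
observer `o`, target `b` and slack `t ≥ 0` with `P(a ↔ b) ≥ 1 − t` for all `a ∈ A`,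
`P(o ↔ A) − t ≤ P(o ↔ b)`.

No new mathematics in this file: the statement is the tree theorem `CSH.additiveGluing_holds`
(file `…Theorems/PercNearOneGluingNoHeavyLowerTailCSHTheoremOne.lean`, prim-hp-8), the last link of the
prim cell's conditioned-slack-hierarchy programme — CSH for every level (`CSH.cshHolds`: induction
skeleton `CSH.cshHolds_of_unfold`, Lemma T `CSH.cshMargin_nonneg_of_within`, Lemma U
`CSH.within_nonneg_of_hpart`, Lemma H `CSH.hpart_nonneg`, (★^H) `CovTauStarN.starH_ED`, A2^H `CovTau.p1H`)
⟹ surplus transfer (S5)_r for every r (`CSH.s5dMargin_nonneg_of_csh`) ⟹ (GEN) ⟹ (AG-loc)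
⟹ `AdditiveGluing` (`CSH.additiveGluing_of_s5dMargin_nondegenerate`, closure over degenerate weights).
This file only reads that theorem at the registered crux declaration under the conventional name.
[cite: KozmaNitzan2024, Conjecture 1 (p. 3), Conjecture 3 (p. 15)]
-/

namespace Summit.CriticalPhenomena.PercolationContinuityZ3.Theorems

/-- **The additive gluing inequality on every finite weighted graph** — the crux `AdditiveGluing` of route
`PercNearOneGluing` (stmt-CriticalPhenomena-4576, registered crux declaration): for `t ≥ 0`,
`(∀ a ∈ A, 1 − t ≤ P(a ↔ b)) ⟹ P(⋃_{a ∈ A} {o ↔ a}) − t ≤ P(o ↔ b)`.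
Proof: the tree theorem `CSH.additiveGluing_holds` (conditioned slack hierarchy ⟹ surplus transfer ⟹ (GEN)
⟹ (AG-loc) ⟹ additive gluing). [cite: KozmaNitzan2024, Conjecture 1 (p. 3)] -/
theorem AdditiveGluing_proof :
    Summit.CriticalPhenomena.PercolationContinuityZ3.Theses.PercNearOneGluing.AdditiveGluing :=
  CSH.additiveGluing_holds

end Summit.CriticalPhenomena.PercolationContinuityZ3.Theorems
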